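import Literature.NumberTheory.LFunctions.DirichletPolynomialMeanValueThm52
import Literature.NumberTheory.LFunctions.DirichletPolynomialMeanValue
import Mathlib.MeasureTheory.Integral.IntervalIntegral.IntegrationByParts
import HarnessLib

/-!
# Rudnick–Sarnak `n`-level correlations for `ζ`, IV: weighted mean values of Dirichlet polynomials

Sibling file of `Literature/NumberTheory/LFunctions/RudnickSarnak.lean` (toward
`Literature.NumberTheory.LFunctions.rudnick_sarnak_unrestricted` at every level). The off-diagonal
analysis of Rudnick–Sarnak 1996, Lemmas 3.2–3.4 (pp. 289–293: the contributions with
`n_1 ⋯ n_r ≠ n_{r+1} ⋯ n_{r+s}` are `O(T)`) is replaced, in the `t`-averaged form of this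
programme (after Montgomery 1973), by the Montgomery–Vaughan mean value theorem, PROVED in the
tree as `Literature.NumberTheory.LFunctions.integral_norm_sq_dirichletPoly_sub_le`
(Ivić 1985, Thm 5.2: `|∫_0^T |Σ a_n n^{it}|² − T Σ|a_n|²| ≤ 928 Σ n |a_n|²`). This file records the
forms in which it is consumed:

* `RudnickSarnakN.dirPoly N a t = Σ_{n=1}^{N} a_n n^{−it}` and its mean value
  (`RudnickSarnakN.abs_integral_norm_sq_dirPoly_sub_le`);
* the **bilinear** form by polarisation: `‖∫_0^T A(t) conj B(t) dt − T Σ a_n conj b_n‖ ≤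
  1856 Σ n(|a_n|² + |b_n|²)` (`RudnickSarnakN.norm_integral_dirPoly_mul_conj_sub_le`);
* the **weighted** bilinear form, for a `C¹` weight `w` (integration by parts against the running
  mean value): `‖∫_0^T w A conj B − (∫_0^T w) Σ a_n conj b_n‖ ≤ (‖w(T)‖ + ∫_0^T ‖w'‖) · 1856 Σ n(|a_n|²+|b_n|²)`
  (`RudnickSarnakN.norm_integral_weight_dirPoly_sub_le`) — used with the density weight
  `ℓ(t)^k ≍ (log t)^k` of the archimedean terms;
* the **damped** mean value `∫_0^T |A(t)|²/(1+t) dt ≤ (36 N + 5 + 5 log(1+T)) Σ |a_n|²`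
  (`RudnickSarnakN.integral_norm_sq_dirPoly_div_le`), from the weak mean value theorem
  `dirichletPolynomial_meanSquare_le`, used to dispose of the decaying error terms.

## References

* Z. Rudnick, P. Sarnak, *Zeros of principal `L`-functions and random matrix theory*, Duke Math.
  J. 81 (1996), 269–322, Lemmas 3.2–3.4.
* A. Ivić, *The Riemann zeta-function* (1985), Thm 5.2.
* H. L. Montgomery, *The pair correlation of zeros of the zeta function* (1973), §2.
-/

noncomputable section

open Complex Filter Set MeasureTheory intervalIntegral
open scoped Real Topology ComplexConjugate

namespace Literature.NumberTheory.LFunctions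

namespace RudnickSarnakN

/-! ## Dirichlet polynomials `Σ_{n ≤ N} a_n n^{−it}` -/

/-- The Dirichlet polynomial `A(t) = Σ_{n=1}^{N} a_n n^{−it}`. [folklore] -/
def dirPoly (N : ℕ) (a : ℕ → ℂ) (t : ℝ) : ℂ :=
  ∑ n ∈ Finset.Icc 1 N, a n * (n : ℂ) ^ (-((t : ℂ) * I))

/-- `n^{−it} = e^{−it log n}` for `n ≥ 1`. [folklore] -/
theorem natCast_cpow_neg_mul_I' {n : ℕ} (hn : n ≠ 0) (t : ℝ) :
    (n : ℂ) ^ (-((t : ℂ) * I)) = cexp (((-(t * Real.log n)) : ℝ) * I) :=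
  natCast_cpow_neg_mul_I hn t

/-- `‖n^{−it}‖ = 1` for `n ≥ 1`. [folklore] -/
theorem norm_natCast_cpow_neg_mul_I {n : ℕ} (hn : n ≠ 0) (t : ℝ) : ‖(n : ℂ) ^ (-((t : ℂ) * I))‖ = 1 := by
  rw [natCast_cpow_neg_mul_I' hn, Complex.norm_exp_ofReal_mul_I]

/-- `conj (n^{−it}) = n^{it}` for `n ≥ 1`. [folklore] -/
theorem conj_natCast_cpow_neg_mul_I {n : ℕ} (hn : n ≠ 0) (t : ℝ) :
    conj ((n : ℂ) ^ (-((t : ℂ) * I))) = (n : ℂ) ^ ((t : ℂ) * I) := by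
  rw [natCast_cpow_neg_mul_I' hn, natCast_cpow_mul_I_eq_cexp hn, ← Complex.exp_conj]
  congr 1
  rw [map_mul, Complex.conj_ofReal, Complex.conj_I]
  push_cast
  ring

/-- `A` is continuous in `t`. [folklore] -/
theorem continuous_dirPoly (N : ℕ) (a : ℕ → ℂ) : Continuous (dirPoly N a) := by
  unfold dirPoly
  refine continuous_finsetSum _ fun n hn ↦ ?_
  have hn0 : n ≠ 0 := by have := (Finset.mem_Icc.1 hn).1; omega
  simp_rw [natCast_cpow_neg_mul_I' hn0]
  fun_prop

/-- Linearity: `dirPoly (a + b) = dirPoly a + dirPoly b`. [folklore] -/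
theorem dirPoly_add (N : ℕ) (a b : ℕ → ℂ) (t : ℝ) :
    dirPoly N (fun n ↦ a n + b n) t = dirPoly N a t + dirPoly N b t := by
  simp [dirPoly, add_mul, Finset.sum_add_distrib]

/-- Linearity: `dirPoly (a − b) = dirPoly a − dirPoly b`. [folklore] -/
theorem dirPoly_sub (N : ℕ) (a b : ℕ → ℂ) (t : ℝ) :
    dirPoly N (fun n ↦ a n - b n) t = dirPoly N a t - dirPoly N b t := by
  simp [dirPoly, sub_mul, Finset.sum_sub_distrib]

/-- Linearity: `dirPoly (c • a) = c · dirPoly a`. [folklore] -/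
theorem dirPoly_const_mul (N : ℕ) (c : ℂ) (a : ℕ → ℂ) (t : ℝ) :
    dirPoly N (fun n ↦ c * a n) t = c * dirPoly N a t := by
  simp [dirPoly, mul_assoc, Finset.mul_sum]

/-- Conjugation: `conj A(t) = Σ conj(a_n) n^{it}`. [folklore] -/
theorem conj_dirPoly (N : ℕ) (a : ℕ → ℂ) (t : ℝ) :
    conj (dirPoly N a t) = ∑ n ∈ Finset.Icc 1 N, conj (a n) * (n : ℂ) ^ ((t : ℂ) * I) := by
  rw [dirPoly, map_sum]
  refine Finset.sum_congr rfl fun n hn ↦ ?_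
  have hn0 : n ≠ 0 := by have := (Finset.mem_Icc.1 hn).1; omega
  rw [map_mul, conj_natCast_cpow_neg_mul_I hn0]

/-- Crude bound: `‖A(t)‖ ≤ Σ ‖a_n‖`. [folklore] -/
theorem norm_dirPoly_le (N : ℕ) (a : ℕ → ℂ) (t : ℝ) : ‖dirPoly N a t‖ ≤ ∑ n ∈ Finset.Icc 1 N, ‖a n‖ := by
  refine (norm_sum_le _ _).trans (Finset.sum_le_sum fun n hn ↦ ?_)
  have hn0 : n ≠ 0 := by have := (Finset.mem_Icc.1 hn).1; omega
  rw [norm_mul, norm_natCast_cpow_neg_mul_I hn0, mul_one]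

/-! ## The mean value theorem (Montgomery–Vaughan / Ivić Thm 5.2) for `n^{−it}` -/

/-- **Mean value theorem** (Ivić 1985 Thm 5.2, `integral_norm_sq_dirichletPoly_sub_le`, for the
frequencies `n^{−it}`): `|∫_0^T |A(t)|² dt − T Σ |a_n|²| ≤ 928 Σ n |a_n|²` for every real `T`.
[cite: Ivic1985, Theorem 5.2] -/
theorem abs_integral_norm_sq_dirPoly_sub_le (N : ℕ) (a : ℕ → ℂ) (T : ℝ) :
    |(∫ t in (0 : ℝ)..T, ‖dirPoly N a t‖ ^ 2) - T * ∑ n ∈ Finset.Icc 1 N, ‖a n‖ ^ 2| ≤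
      928 * ∑ n ∈ Finset.Icc 1 N, (n : ℝ) * ‖a n‖ ^ 2 := by
  have h := integral_norm_sq_dirichletPoly_sub_le N (fun n ↦ conj (a n)) T
  have e1 : ∀ t : ℝ, ‖∑ n ∈ Finset.Icc 1 N, conj (a n) * (n : ℂ) ^ ((t : ℂ) * I)‖ = ‖dirPoly N a t‖ := by
    intro t
    rw [← conj_dirPoly, Complex.norm_conj]
  simp_rw [e1, Complex.norm_conj] at h
  exact h

/-- The polarisation identity `z conj w = (|z+w|² − |z−w|²)/4 + i (|z+iw|² − |z−iw|²)/4`.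
[folklore] -/
theorem mul_conj_eq_polarization (z w : ℂ) :
    z * conj w = ((‖z + w‖ ^ 2 - ‖z - w‖ ^ 2 : ℝ) : ℂ) / 4 +
      I * ((‖z + I * w‖ ^ 2 - ‖z - I * w‖ ^ 2 : ℝ) : ℂ) / 4 := by
  simp only [Complex.sq_norm, Complex.normSq_apply]
  apply Complex.ext
  · simp; ring
  · simp; ring

/-- **Bilinear mean value theorem** (polarisation of Ivić Thm 5.2): for every real `T`,
`‖∫_0^T A(t) conj B(t) dt − T Σ a_n conj b_n‖ ≤ 1856 Σ n (|a_n|² + |b_n|²)`. [cite: Ivic1985, Theorem 5.2] -/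
theorem norm_integral_dirPoly_mul_conj_sub_le (N : ℕ) (a b : ℕ → ℂ) (T : ℝ) :
    ‖(∫ t in (0 : ℝ)..T, dirPoly N a t * conj (dirPoly N b t)) -
        T * ∑ n ∈ Finset.Icc 1 N, a n * conj (b n)‖ ≤
      1856 * ∑ n ∈ Finset.Icc 1 N, (n : ℝ) * (‖a n‖ ^ 2 + ‖b n‖ ^ 2) := by
  set s := Finset.Icc 1 N
  -- the four combinations
  set c₁ : ℕ → ℂ := fun n ↦ a n + b n
  set c₂ : ℕ → ℂ := fun n ↦ a n - b n
  set c₃ : ℕ → ℂ := fun n ↦ a n + I * b n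
  set c₄ : ℕ → ℂ := fun n ↦ a n - I * b n
  set p₁ : ℝ → ℝ := fun t ↦ ‖dirPoly N c₁ t‖ ^ 2
  set p₂ : ℝ → ℝ := fun t ↦ ‖dirPoly N c₂ t‖ ^ 2
  set p₃ : ℝ → ℝ := fun t ↦ ‖dirPoly N c₃ t‖ ^ 2
  set p₄ : ℝ → ℝ := fun t ↦ ‖dirPoly N c₄ t‖ ^ 2
  have hF : ∀ t, dirPoly N a t * conj (dirPoly N b t) =
      (((p₁ t - p₂ t) / 4 : ℝ) : ℂ) + I * (((p₃ t - p₄ t) / 4 : ℝ) : ℂ) := by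
    intro t
    rw [mul_conj_eq_polarization]
    simp only [p₁, p₂, p₃, p₄, c₁, c₂, c₃, c₄, dirPoly_add, dirPoly_sub, dirPoly_const_mul]
    push_cast
    ring
  set S₁ : ℝ := ∑ n ∈ s, ‖c₁ n‖ ^ 2
  set S₂ : ℝ := ∑ n ∈ s, ‖c₂ n‖ ^ 2
  set S₃ : ℝ := ∑ n ∈ s, ‖c₃ n‖ ^ 2
  set S₄ : ℝ := ∑ n ∈ s, ‖c₄ n‖ ^ 2
  have hD : ∑ n ∈ s, a n * conj (b n) = (((S₁ - S₂) / 4 : ℝ) : ℂ) + I * (((S₃ - S₄) / 4 : ℝ) : ℂ) := by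
    calc ∑ n ∈ s, a n * conj (b n)
        = ∑ n ∈ s, ((((‖c₁ n‖ ^ 2 - ‖c₂ n‖ ^ 2 : ℝ) : ℂ)) / 4 + I * ((‖c₃ n‖ ^ 2 - ‖c₄ n‖ ^ 2 : ℝ) : ℂ) / 4) :=
          Finset.sum_congr rfl fun n _ ↦ mul_conj_eq_polarization (a n) (b n)
      _ = (∑ n ∈ s, ((‖c₁ n‖ ^ 2 - ‖c₂ n‖ ^ 2 : ℝ) : ℂ)) / 4 + I * (∑ n ∈ s, ((‖c₃ n‖ ^ 2 - ‖c₄ n‖ ^ 2 : ℝ) : ℂ)) / 4 := by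
          rw [Finset.sum_add_distrib, ← Finset.sum_div, ← Finset.sum_div, ← Finset.mul_sum]
      _ = (((S₁ - S₂) / 4 : ℝ) : ℂ) + I * (((S₃ - S₄) / 4 : ℝ) : ℂ) := by
          simp only [S₁, S₂, S₃, S₄]
          push_cast
          rw [Finset.sum_sub_distrib, Finset.sum_sub_distrib]
          ring
  -- integrability of the four squares
  have hpc : ∀ c : ℕ → ℂ, Continuous fun t ↦ ‖dirPoly N c t‖ ^ 2 := fun c ↦ (continuous_dirPoly N c).norm.pow 2
  set I₁ : ℝ := ∫ t in (0 : ℝ)..T, p₁ t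
  set I₂ : ℝ := ∫ t in (0 : ℝ)..T, p₂ t
  set I₃ : ℝ := ∫ t in (0 : ℝ)..T, p₃ t
  set I₄ : ℝ := ∫ t in (0 : ℝ)..T, p₄ t
  have hU : (∫ t in (0 : ℝ)..T, (((p₁ t - p₂ t) / 4 : ℝ) : ℂ)) = (((I₁ - I₂) / 4 : ℝ) : ℂ) := by
    rw [intervalIntegral.integral_ofReal, intervalIntegral.integral_div,
      intervalIntegral.integral_sub ((hpc c₁).intervalIntegrable _ _) ((hpc c₂).intervalIntegrable _ _)]
  have hV : (∫ t in (0 : ℝ)..T, I * (((p₃ t - p₄ t) / 4 : ℝ) : ℂ)) = I * (((I₃ - I₄) / 4 : ℝ) : ℂ) := by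
    rw [intervalIntegral.integral_const_mul, intervalIntegral.integral_ofReal, intervalIntegral.integral_div,
      intervalIntegral.integral_sub ((hpc c₃).intervalIntegrable _ _) ((hpc c₄).intervalIntegrable _ _)]
  have hUi : IntervalIntegrable (fun t ↦ (((p₁ t - p₂ t) / 4 : ℝ) : ℂ)) volume 0 T :=
    (Complex.continuous_ofReal.comp (((hpc c₁).sub (hpc c₂)).div_const 4)).intervalIntegrable _ _
  have hVi : IntervalIntegrable (fun t ↦ I * (((p₃ t - p₄ t) / 4 : ℝ) : ℂ)) volume 0 T :=
    ((Complex.continuous_ofReal.comp (((hpc c₃).sub (hpc c₄)).div_const 4)).const_mul I).intervalIntegrable _ _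
  have hI : (∫ t in (0 : ℝ)..T, dirPoly N a t * conj (dirPoly N b t)) =
      (((I₁ - I₂) / 4 : ℝ) : ℂ) + I * (((I₃ - I₄) / 4 : ℝ) : ℂ) := by
    simp_rw [hF]
    rw [intervalIntegral.integral_add hUi hVi, hU, hV]
  -- the four mean value theorems
  have hMV : ∀ c : ℕ → ℂ, |(∫ t in (0 : ℝ)..T, ‖dirPoly N c t‖ ^ 2) - T * ∑ n ∈ s, ‖c n‖ ^ 2| ≤
      928 * ∑ n ∈ s, (n : ℝ) * ‖c n‖ ^ 2 := fun c ↦ abs_integral_norm_sq_dirPoly_sub_le N c T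
  have hpar : ∀ n : ℕ, ∀ ε : ℂ, ‖ε‖ = 1 → ‖a n + ε * b n‖ ^ 2 ≤ 2 * (‖a n‖ ^ 2 + ‖b n‖ ^ 2) := by
    intro n ε hε
    have h1 : ‖a n + ε * b n‖ ≤ ‖a n‖ + ‖b n‖ := by
      refine (norm_add_le _ _).trans ?_; rw [norm_mul, hε, one_mul]
    have h2 := pow_le_pow_left₀ (norm_nonneg _) h1 2
    nlinarith [sq_nonneg (‖a n‖ - ‖b n‖)]
  have hsum : ∀ ε : ℂ, ‖ε‖ = 1 → ∑ n ∈ s, (n : ℝ) * ‖a n + ε * b n‖ ^ 2 ≤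
      2 * ∑ n ∈ s, (n : ℝ) * (‖a n‖ ^ 2 + ‖b n‖ ^ 2) := by
    intro ε hε
    rw [Finset.mul_sum]
    refine Finset.sum_le_sum fun n _ ↦ ?_
    have := hpar n ε hε
    have hn : (0 : ℝ) ≤ n := Nat.cast_nonneg n
    nlinarith
  have h1 := hMV c₁
  have h2 := hMV c₂
  have h3 := hMV c₃
  have h4 := hMV c₄
  have hs1 := hsum 1 (by simp)
  have hs2 := hsum (-1) (by simp)
  have hs3 := hsum I (by simp)
  have hs4 := hsum (-I) (by simp)
  simp only [one_mul, neg_mul, ← sub_eq_add_neg] at hs1 hs2 hs4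
  set S := ∑ n ∈ s, (n : ℝ) * (‖a n‖ ^ 2 + ‖b n‖ ^ 2)
  set X₁ := I₁ - T * S₁
  set X₂ := I₂ - T * S₂
  set X₃ := I₃ - T * S₃
  set X₄ := I₄ - T * S₄
  rw [hI, hD]
  have e : (((I₁ - I₂) / 4 : ℝ) : ℂ) + I * (((I₃ - I₄) / 4 : ℝ) : ℂ) -
        T * ((((S₁ - S₂) / 4 : ℝ) : ℂ) + I * (((S₃ - S₄) / 4 : ℝ) : ℂ)) =
      ((X₁ - X₂ : ℝ) : ℂ) / 4 + I * ((X₃ - X₄ : ℝ) : ℂ) / 4 := by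
    simp only [X₁, X₂, X₃, X₄]
    push_cast
    ring
  rw [e]
  calc ‖((X₁ - X₂ : ℝ) : ℂ) / 4 + I * ((X₃ - X₄ : ℝ) : ℂ) / 4‖
      ≤ ‖((X₁ - X₂ : ℝ) : ℂ) / 4‖ + ‖I * ((X₃ - X₄ : ℝ) : ℂ) / 4‖ := norm_add_le _ _
    _ = |X₁ - X₂| / 4 + |X₃ - X₄| / 4 := by
        rw [norm_div, norm_div, norm_mul, Complex.norm_I, one_mul, Complex.norm_real, Complex.norm_real,
          Real.norm_eq_abs, Real.norm_eq_abs]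
        norm_num
    _ ≤ (|X₁| + |X₂|) / 4 + (|X₃| + |X₄|) / 4 := by
        gcongr <;> exact abs_sub _ _
    _ ≤ 1856 * S := by
        simp only [X₁, X₂, X₃, X₄, I₁, I₂, I₃, I₄, S₁, S₂, S₃, S₄, p₁, p₂, p₃, p₄, c₁, c₂, c₃, c₄] at h1 h2 h3 h4 ⊢
        linarith

/-! ## Integration by parts against a running integral -/

/-- **Abel summation in integral form**: for continuous `φ` and a weight `w` with a continuous
derivative on `[0, T]` (`T ≥ 0`),
`∫_0^T w φ = w(T) ∫_0^T φ − ∫_0^T w'(t) (∫_0^t φ) dt`. [folklore] -/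
theorem integral_weight_mul_eq {φ w w' : ℝ → ℂ} (hφ : Continuous φ) {T : ℝ} (hT : 0 ≤ T)
    (hw : ∀ t ∈ Icc 0 T, HasDerivAt w (w' t) t) (hw' : ContinuousOn w' (Icc 0 T)) :
    ∫ t in (0 : ℝ)..T, w t * φ t =
      w T * (∫ t in (0 : ℝ)..T, φ t) - ∫ t in (0 : ℝ)..T, w' t * ∫ u in (0 : ℝ)..t, φ u := by
  have hI : uIcc 0 T = Icc 0 T := uIcc_of_le hT
  have hv : ∀ t ∈ uIcc 0 T, HasDerivAt (fun s ↦ ∫ u in (0 : ℝ)..s, φ u) (φ t) t :=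
    fun t _ ↦ (hφ.integral_hasStrictDerivAt 0 t).hasDerivAt
  have hu : ∀ t ∈ uIcc 0 T, HasDerivAt w (w' t) t := by rw [hI]; exact hw
  have hw'i : IntervalIntegrable w' volume 0 T := hw'.intervalIntegrable_of_Icc hT
  have h := intervalIntegral.integral_mul_deriv_eq_deriv_mul hu hv hw'i (hφ.intervalIntegrable _ _)
  rw [h]
  simp

/-! ## The weighted bilinear mean value theorem -/

/-- **Weighted bilinear mean value theorem**: for a weight `w` with continuous derivative on
`[0, T]` (`T ≥ 0`),
`‖∫_0^T w(t) A(t) conj B(t) dt − (∫_0^T w) Σ a_n conj b_n‖ ≤ (‖w(T)‖ + ∫_0^T ‖w'‖) · 1856 Σ n(|a_n|² + |b_n|²)`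
(integration by parts against the running bilinear mean value, which is uniformly within
`1856 Σ n(|a_n|²+|b_n|²)` of `t Σ a_n conj b_n`). This is the form in which the diagonal terms
`M = N` of Rudnick–Sarnak 1996, (3.33)–(3.36), are extracted here. [cite: RudnickSarnak1996, (3.33)–(3.36)] -/
theorem norm_integral_weight_dirPoly_sub_le (N : ℕ) (a b : ℕ → ℂ) {w w' : ℝ → ℂ} {T : ℝ} (hT : 0 ≤ T)
    (hw : ∀ t ∈ Icc 0 T, HasDerivAt w (w' t) t) (hw' : ContinuousOn w' (Icc 0 T)) :
    ‖(∫ t in (0 : ℝ)..T, w t * (dirPoly N a t * conj (dirPoly N b t))) -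
        (∫ t in (0 : ℝ)..T, w t) * ∑ n ∈ Finset.Icc 1 N, a n * conj (b n)‖ ≤
      (‖w T‖ + ∫ t in (0 : ℝ)..T, ‖w' t‖) * (1856 * ∑ n ∈ Finset.Icc 1 N, (n : ℝ) * (‖a n‖ ^ 2 + ‖b n‖ ^ 2)) := by
  set D : ℂ := ∑ n ∈ Finset.Icc 1 N, a n * conj (b n)
  set B : ℝ := 1856 * ∑ n ∈ Finset.Icc 1 N, (n : ℝ) * (‖a n‖ ^ 2 + ‖b n‖ ^ 2)
  set φ : ℝ → ℂ := fun t ↦ dirPoly N a t * conj (dirPoly N b t)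
  have hφ : Continuous φ := (continuous_dirPoly N a).mul (Complex.continuous_conj.comp (continuous_dirPoly N b))
  set U : ℝ → ℂ := fun t ↦ (∫ u in (0 : ℝ)..t, φ u) - t * D
  have hU : ∀ t, ‖U t‖ ≤ B := fun t ↦ norm_integral_dirPoly_mul_conj_sub_le N a b t
  have hB0 : 0 ≤ B := le_trans (norm_nonneg _) (hU 0)
  -- integration by parts, twice
  have h1 := integral_weight_mul_eq hφ hT hw hw'
  have h2 := integral_weight_mul_eq (φ := fun _ ↦ (1 : ℂ)) continuous_const hT hw hw'
  simp only [mul_one, intervalIntegral.integral_const, sub_zero, Complex.real_smul] at h2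
  have hV : ∀ t, (∫ u in (0 : ℝ)..t, φ u) = U t + t * D := fun t ↦ by simp [U]
  simp_rw [hV] at h1
  -- `∫ w φ − (∫ w) D = w(T) U(T) − ∫ w' U`
  have hw'i : IntervalIntegrable w' volume 0 T := hw'.intervalIntegrable_of_Icc hT
  have hUc : Continuous U := by
    simp only [U]
    exact (continuous_primitive hφ.intervalIntegrable 0).sub (by fun_prop)
  have hwUi : IntervalIntegrable (fun t ↦ w' t * U t) volume 0 T :=
    hw'i.mul_continuousOn hUc.continuousOn
  have hwti : IntervalIntegrable (fun t ↦ w' t * (t * D)) volume 0 T :=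
    hw'i.mul_continuousOn (by fun_prop)
  have key : (∫ t in (0 : ℝ)..T, w t * φ t) - (∫ t in (0 : ℝ)..T, w t) * D =
      w T * U T - ∫ t in (0 : ℝ)..T, w' t * U t := by
    rw [h1, h2]
    have : (∫ t in (0 : ℝ)..T, w' t * (U t + t * D)) =
        (∫ t in (0 : ℝ)..T, w' t * U t) + ∫ t in (0 : ℝ)..T, w' t * (t * D) := by
      rw [← intervalIntegral.integral_add hwUi hwti]
      congr 1 with t; ring
    rw [this]
    have : (∫ t in (0 : ℝ)..T, w' t * (t * D)) = (∫ t in (0 : ℝ)..T, w' t * t) * D := by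
      rw [← intervalIntegral.integral_mul_const]; congr 1 with t; ring
    rw [this]
    ring
  rw [key]
  calc ‖w T * U T - ∫ t in (0 : ℝ)..T, w' t * U t‖
      ≤ ‖w T * U T‖ + ‖∫ t in (0 : ℝ)..T, w' t * U t‖ := norm_sub_le _ _
    _ ≤ ‖w T‖ * B + ∫ t in (0 : ℝ)..T, ‖w' t‖ * B := by
        refine add_le_add ?_ ?_
        · rw [norm_mul]; exact mul_le_mul_of_nonneg_left (hU T) (norm_nonneg _)
        · refine intervalIntegral.norm_integral_le_of_norm_le hT ?_ (hw'i.norm.mul_const B)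
          exact Eventually.of_forall fun t _ ↦ by rw [norm_mul]; exact mul_le_mul_of_nonneg_left (hU t) (norm_nonneg _)
    _ = (‖w T‖ + ∫ t in (0 : ℝ)..T, ‖w' t‖) * B := by
        rw [intervalIntegral.integral_mul_const]; ring

/-! ## The damped mean value `∫ |A|²/(1+t)` -/

/-- Running mean square: `∫_0^t |A|² ≤ (5t + 18N) Σ |a_n|²` for `t ≥ 0`
(`dirichletPolynomial_meanSquare_le` on `[−t, t]` ⊇ `[0, t]`). [cite: Ivic1985, Theorem 5.2 (weak form)] -/
theorem integral_norm_sq_dirPoly_le (N : ℕ) (a : ℕ → ℂ) {t : ℝ} (ht : 0 ≤ t) :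
    ∫ u in (0 : ℝ)..t, ‖dirPoly N a u‖ ^ 2 ≤ (5 * t + 18 * N) * ∑ n ∈ Finset.Icc 1 N, ‖a n‖ ^ 2 := by
  rcases ht.eq_or_lt with rfl | ht'
  · simp; positivity
  have h := dirichletPolynomial_meanSquare_le a N ht'
  refine le_trans ?_ h
  have hc : Continuous fun u ↦ ‖dirPoly N a u‖ ^ 2 := (continuous_dirPoly N a).norm.pow 2
  refine intervalIntegral.integral_mono_interval (by linarith) ht le_rfl ?_ (hc.intervalIntegrable _ _)
  exact Eventually.of_forall fun u ↦ by positivity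

/-- **Damped mean value**: for `T ≥ 0`,
`∫_0^T |A(t)|²/(1+t) dt ≤ (36 N + 5 + 5 log(1+T)) Σ |a_n|²` (integration by parts with the
weight `1/(1+t)` against the running mean square). [folklore] -/
theorem integral_norm_sq_dirPoly_div_le (N : ℕ) (a : ℕ → ℂ) {T : ℝ} (hT : 0 ≤ T) :
    ∫ t in (0 : ℝ)..T, ‖dirPoly N a t‖ ^ 2 / (1 + t) ≤
      (36 * N + 5 + 5 * Real.log (1 + T)) * ∑ n ∈ Finset.Icc 1 N, ‖a n‖ ^ 2 := by
  set S : ℝ := ∑ n ∈ Finset.Icc 1 N, ‖a n‖ ^ 2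
  have hS : 0 ≤ S := Finset.sum_nonneg fun n _ ↦ by positivity
  set φ : ℝ → ℂ := fun t ↦ ((‖dirPoly N a t‖ ^ 2 : ℝ) : ℂ)
  have hφ : Continuous φ := Complex.continuous_ofReal.comp ((continuous_dirPoly N a).norm.pow 2)
  set w : ℝ → ℂ := fun t ↦ (((1 + t)⁻¹ : ℝ) : ℂ)
  set w' : ℝ → ℂ := fun t ↦ ((-((1 + t) ^ 2)⁻¹ : ℝ) : ℂ)
  have hw : ∀ t ∈ Icc 0 T, HasDerivAt w (w' t) t := by
    intro t ht
    have hne : (1 + t) ≠ 0 := by have := ht.1; positivity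
    have h1 : HasDerivAt (fun s : ℝ ↦ (1 + s)⁻¹) (-((1 + t) ^ 2)⁻¹) t :=
      (((hasDerivAt_id' t).const_add 1).inv hne).congr_deriv (by ring)
    exact h1.ofReal_comp
  have hw' : ContinuousOn w' (Icc 0 T) := by
    have : ContinuousOn (fun t : ℝ ↦ -((1 + t) ^ 2)⁻¹) (Icc 0 T) :=
      ContinuousOn.neg (ContinuousOn.inv₀ (by fun_prop) fun t ht ↦ by have := ht.1; positivity)
    exact Complex.continuous_ofReal.comp_continuousOn this
  have h := integral_weight_mul_eq hφ hT hw hw'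
  -- real parts
  set V : ℝ → ℝ := fun t ↦ ∫ u in (0 : ℝ)..t, ‖dirPoly N a u‖ ^ 2
  have hVφ : ∀ t, (∫ u in (0 : ℝ)..t, φ u) = ((V t : ℝ) : ℂ) := fun t ↦ intervalIntegral.integral_ofReal
  have hVb : ∀ t, 0 ≤ t → V t ≤ (5 * t + 18 * N) * S := fun t ht ↦ integral_norm_sq_dirPoly_le N a ht
  simp_rw [hVφ] at h
  have e_lhs : (∫ t in (0 : ℝ)..T, w t * φ t) = (((∫ t in (0 : ℝ)..T, ‖dirPoly N a t‖ ^ 2 / (1 + t)) : ℝ) : ℂ) := by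
    rw [← intervalIntegral.integral_ofReal]
    congr 1 with t
    simp only [w, φ]
    push_cast
    ring
  have e_rhs : w T * ((V T : ℝ) : ℂ) - ∫ t in (0 : ℝ)..T, w' t * ((V t : ℝ) : ℂ) =
      ((((1 + T)⁻¹ * V T + ∫ t in (0 : ℝ)..T, ((1 + t) ^ 2)⁻¹ * V t) : ℝ) : ℂ) := by
    have : (∫ t in (0 : ℝ)..T, w' t * ((V t : ℝ) : ℂ)) = (((∫ t in (0 : ℝ)..T, -(((1 + t) ^ 2)⁻¹ * V t)) : ℝ) : ℂ) := by
      rw [← intervalIntegral.integral_ofReal]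
      congr 1 with t
      simp only [w']
      push_cast
      ring
    rw [this, intervalIntegral.integral_neg]
    simp only [w]
    push_cast
    ring
  have hre : (∫ t in (0 : ℝ)..T, ‖dirPoly N a t‖ ^ 2 / (1 + t)) =
      (1 + T)⁻¹ * V T + ∫ t in (0 : ℝ)..T, ((1 + t) ^ 2)⁻¹ * V t := by
    rw [e_lhs, e_rhs] at h
    exact_mod_cast h
  rw [hre]
  -- bound the two pieces
  have hVc : Continuous V := by
    simp only [V]
    exact continuous_primitive ((continuous_dirPoly N a).norm.pow 2).intervalIntegrable 0
  have h1 : (1 + T)⁻¹ * V T ≤ (5 + 18 * N) * S := by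
    have hb := hVb T hT
    rw [inv_mul_le_iff₀ (by positivity)]
    nlinarith [mul_nonneg hT hS, mul_nonneg (mul_nonneg hT (Nat.cast_nonneg N)) hS]
  -- `∫_0^T V/(1+t)² ≤ ∫_0^T (5/(1+t) + 18N/(1+t)²) S = (5 log(1+T) + 18N (1 - 1/(1+T))) S`
  set G : ℝ → ℝ := fun t ↦ 5 * Real.log (1 + t) - 18 * N * (1 + t)⁻¹
  have hG : ∀ t ∈ uIcc 0 T, HasDerivAt G (5 * (1 + t)⁻¹ + 18 * N * ((1 + t) ^ 2)⁻¹) t := by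
    intro t ht
    rw [uIcc_of_le hT] at ht
    have hpos : 0 < 1 + t := by have := ht.1; positivity
    have d1 : HasDerivAt (fun s : ℝ ↦ Real.log (1 + s)) ((1 + t)⁻¹) t :=
      (((hasDerivAt_id' t).const_add 1).log hpos.ne').congr_deriv (by ring)
    have d2 : HasDerivAt (fun s : ℝ ↦ (1 + s)⁻¹) (-((1 + t) ^ 2)⁻¹) t :=
      (((hasDerivAt_id' t).const_add 1).inv hpos.ne').congr_deriv (by ring)
    exact ((d1.const_mul 5).sub (d2.const_mul (18 * (N : ℝ)))).congr_deriv (by ring)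
  have hGint : IntervalIntegrable (fun t ↦ 5 * (1 + t)⁻¹ + 18 * N * ((1 + t) ^ 2)⁻¹) volume 0 T := by
    refine ContinuousOn.intervalIntegrable ?_
    rw [uIcc_of_le hT]
    refine ContinuousOn.add (ContinuousOn.mul continuousOn_const (ContinuousOn.inv₀ (by fun_prop) fun t ht ↦ ?_))
      (ContinuousOn.mul continuousOn_const (ContinuousOn.inv₀ (by fun_prop) fun t ht ↦ ?_))
    · have := ht.1; positivity
    · have := ht.1; positivity
  have h2 : ∫ t in (0 : ℝ)..T, ((1 + t) ^ 2)⁻¹ * V t ≤ (5 * Real.log (1 + T) + 18 * N) * S := by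
    have hmono : ∫ t in (0 : ℝ)..T, ((1 + t) ^ 2)⁻¹ * V t ≤
        ∫ t in (0 : ℝ)..T, (5 * (1 + t)⁻¹ + 18 * N * ((1 + t) ^ 2)⁻¹) * S := by
      refine intervalIntegral.integral_mono_on hT ?_ (hGint.mul_const S) fun t ht ↦ ?_
      · refine ContinuousOn.intervalIntegrable ?_
        rw [uIcc_of_le hT]
        exact ContinuousOn.mul (ContinuousOn.inv₀ (by fun_prop) fun t ht ↦ by have := ht.1; positivity)
          hVc.continuousOn
      · have hpos : 0 < 1 + t := by have := ht.1; positivity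
        have hb := hVb t ht.1
        calc ((1 + t) ^ 2)⁻¹ * V t ≤ ((1 + t) ^ 2)⁻¹ * ((5 * t + 18 * N) * S) :=
              mul_le_mul_of_nonneg_left hb (by positivity)
          _ ≤ (5 * (1 + t)⁻¹ + 18 * N * ((1 + t) ^ 2)⁻¹) * S := by
              rw [← mul_assoc]
              refine mul_le_mul_of_nonneg_right ?_ hS
              rw [show 5 * (1 + t)⁻¹ = 5 * (1 + t) * ((1 + t) ^ 2)⁻¹ by field_simp, ← add_mul, mul_comm]
              refine mul_le_mul_of_nonneg_right (by nlinarith) (by positivity)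
    refine hmono.trans ?_
    rw [intervalIntegral.integral_mul_const, intervalIntegral.integral_eq_sub_of_hasDerivAt hG hGint]
    simp only [G, add_zero, Real.log_one, mul_zero, zero_sub, inv_one, mul_one]
    have : 0 ≤ 18 * (N : ℝ) * (1 + T)⁻¹ := by positivity
    nlinarith
  calc (1 + T)⁻¹ * V T + ∫ t in (0 : ℝ)..T, ((1 + t) ^ 2)⁻¹ * V t
      ≤ (5 + 18 * N) * S + (5 * Real.log (1 + T) + 18 * N) * S := add_le_add h1 h2
    _ = (36 * N + 5 + 5 * Real.log (1 + T)) * S := by ring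

end RudnickSarnakN

end Literature.NumberTheory.LFunctions

end
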